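import Summits.SmoothPoincare4.SmoothPoincare4.Theses.ConvexBisection
import Literature.Topology.FourManifolds.HomotopyS4CompactProofs
import HarnessLib
import HarnessLib.Audit

/-!
# Line `braided-branch-locus` for crux `ConvexBisection.AcyclicBisectionExists`
(item stmt-SmoothPoincare4-10508, route `route-SmoothPoincare4-ConvexBisection`, rank 3)

Skeleton (crux-plan, planner-cruxplan-stmt-SmoothPoincare4-10508-braided-branch-locus-0,
2026-08-16) of the crux idea `Cruxes/AcyclicBisectionExists/Ideas/braided-branch-locus.md`
(ideator 1, round 1; triage TRIAGE-r1-1/2/3: pass ×3 "with doubt on reach / generality").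

THE CRUX. Every Hausdorff second-countable `C^∞` 4-manifold `M ≃ₕ S⁴` is covered by two smoothly
embedded compact Stein domains `e₁(W₁) ∪ e₂(W₂)` meeting exactly along the images of their
boundaries, with the complex tangencies pushed forward to ONE plane field on the seam, both halves
ℚ-acyclic in positive degrees.

THE LEVER (card). Present `M` as a simple branched cover `p : M → S⁴` whose branch locus `F` is a
closed ORIENTABLE surface in closed surface-braid position `F ⊂ D²_z × S² ⊂ S⁴` (Kamada), SORT the
braid's branch points by chirality with the equator of the base `S²` (positive twists north, negative
twists south), and PULL BACK the hemisphere bisection `S⁴ = B₊ ∪ B₋`: `W₁ = p⁻¹(B₊)` and `-W₂ =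
-p⁻¹(B₋)` are covers of a bidisc branched over POSITIVE braided surfaces, hence Stein
(Loi–Piergallini 2001 Thm 2.2), and both fill the SAME contact manifold (the cover of `S³` branched
along one transverse closed braid `L = F ∩ S³`, both boundary open books being the lift of the one
braid-axis open book of the seam) — matching costs nothing; `χ(Wᵢ) = 1` is an exponent sum;
ℚ-acyclicity of the halves is a spanning/connectivity condition on the positive bands, reached by
Hurwitz moves (re-choice of the sorting disc).

FIXED COORDINATES (§0). `S⁴ = {|z|² + |w|² + t² = 1} ⊂ ℂ_z × ℂ_w × ℝ_t = ℝ⁵` (indices 0,1 | 2,3 | 4),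
the carrier of the summit statement. Braid region `T° = {|z|² < 1/2} ≅ D̊²_z × S²` with braid
projection `π(x) = (w,t)/‖(w,t)‖ ∈ S²`; hemispheres `B₊ = {t ≥ 0}`, `B₋ = {t ≤ 0}`, seam
`E = {t = 0} = S³ ⊂ ℂ²` with `L ⊂ {|z|² ≤ 1/2}` a closed braid about the axis `{w = 0}`; the
normalised base coordinate `w' = wS ∘ π` makes `(z, w')` an orientation-preserving complex chart of
`B₊ ∩ T°` in which the braid fibration is `{w' = const}` (checked at the north pole: the boundary
orientation of `S⁴ = ∂B⁵` is `(∂₀,∂₁,∂₂,∂₃)`).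

THE CHAIN (six registered stubs; each arrow lands in a local relational predicate of §1):

  `M ≃ₕ S⁴`
  —[`stub_orientableBranchedCover` = K1 "Q_or", OPEN: `∃ d ≥ 2`, simple `d`-fold branched cover
     `p : M → S⁴` with closed orientable embedded branch surface, product tubes]→ `IsSimpleBranchedCover`
  —[`stub_kamadaBraiding`, KNOWN (Viro–Kamada 1994 Thm 1): ambient isotopy of `S⁴` into closed
     simple surface-braid position]→ `IsSimpleBranchedCover ∧ IsSurfaceBraid`
  —[`d = 2`: `stub_signSortingDegreeTwo` (Kamada's dictionary; Smith theory makes `F` a 2-knot)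
     fed by `stub_hurwitzTransitive` (pure combinatorics, the card's brute-forced First lemma) |
     `d ≥ 3`: `stub_signSortingHigherDegree`, OPEN (spanning of lifted positive band cycles)]→
     `IsSimpleBranchedCover ∧ IsSortedSurfaceBraid ∧ p⁻¹(B₊), p⁻¹(B₋) ℚ-acyclic`
  —[`stub_pullbackSteinBisection`, KNOWN/XL (Loi–Piergallini Thm 2.2 + Prop 1.2, HKP §2.5 /
     Plamenevskaya, Giroux uniqueness, Gray, collar): Stein bisection with `range eᵢ = p⁻¹(B_±)`]→
  transport of `IsZero` along `Wᵢ ≃ₜ range eᵢ` (`singularHomology.mapIso`) ⇒ the crux.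

`AcyclicBisectionExists_of` is PROVED below (no `sorry` of its own; ≈ 20 lines of logic) and concludes
the route decl BY NAME; `hasAcyclicSteinBisection_of_doubleBranchedCover` is the card's unconditional
stratum theorem P2 (double branched covers of 2-knots) modulo the KNOWN stubs 2, 4, 6 and the
combinatorial stub 3 — no `Q_or` there.

DISPROOF.LEAN HONOURED (cdisprove gen 2 v5, 2026-08-15T23:23Z; read through its ledger evidence notes —
the evidence store `run/gate/evidence` is not mounted on this box and no `Cruxes/…/Disproof.lean` is
published): `acyclicBisectionExists_false_without_homotopyEquiv` — `M ≃ₕ S⁴` is consumed three times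
(compactness of `M` via the tree theorem `compactSpace_of_homotopyEquiv_sphere_four_holds`; hypothesis of
Stub 1, where the Viro signature obstruction `σ(M) = 0` for orientable embedded branch sets lives; hypothesis
of Stubs 4/5, where `χ(M) = 2` gives the Euler balance `n₊ = n₋ = rank H₁(page)` and Smith theory / `b₁ = 0`
the connectivity); `not_acyclicBisectionExistsForSimplyConnectedClosed` (ℂP²) — consistent: ℂP² has
`σ ≠ 0`, so it has NO cover with orientable embedded branch surface (Stub 1 is correctly restricted to
homotopy spheres, triage r1-2's sharpening); `not_acyclicBisectionExistsAllDegrees` — every acyclicity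
clause keeps the guard `0 < k`; junk models (`hasAcyclicBisection_of_isEmpty`, one-piece bisections) —
irrelevant: both halves here are covers of 4-balls with seam `p⁻¹(S³)`; `acyclicRight_of_acyclicLeft` /
`acyclic_iff_seam` — not needed as stubs: the sorting stubs deliver BOTH hemisphere preimages acyclic
(for `d = 2` both `F ∩ B_±` are discs), a lead may use the Disproof lemma to halve Stub 5's burden.
No Negative/ lemma has landed for this crux; `ledger negatives --problem SmoothPoincare4` = 0, so no stub
instance is refuted.

The predicates of §1 are DEFINITION REQUESTS (card D1): when `IsSimpleBranchedCover` /
`IsSurfaceBraid` / `IsSortedSurfaceBraid` land in `Literature/Topology/FourManifolds`, the lead re-points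
the stubs; until then they live here, fully unfolded over Mathlib + the fixed coordinates.
-/

noncomputable section

open scoped Manifold ContDiff Topology ContinuousMap
open Set Function
open CategoryTheory CategoryTheory.Limits
open Literature.Geometry.Symplectic Literature.AlgebraicTopology.SingularHomology

-- The namespace is prescribed by the crux protocol (`Summit.<P>.<Sub>.Cruxes.<Crux>.<Slug>` with
-- `P = Sub = SmoothPoincare4`), hence the duplicated component.
set_option linter.dupNamespace false

namespace Summit.SmoothPoincare4.SmoothPoincare4.Cruxes.AcyclicBisectionExists.BraidedBranchLocus

/-! ## §0 Fixed coordinates on `S⁴ ⊂ ℂ_z × ℂ_w × ℝ_t = ℝ⁵` -/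

/-- Local notation: `𝔼 n = ℝⁿ` (model space). -/
local notation "𝔼 " n:arg => EuclideanSpace ℝ (Fin n)
/-- Local notation: the round `4`-sphere `S⁴ ⊂ ℝ⁵`, exactly the carrier of the summit statement. -/
local notation "𝕊⁴" => (Metric.sphere (0 : EuclideanSpace ℝ (Fin 5)) 1)
/-- Local notation: the round `2`-sphere `S² ⊂ ℝ³` (base of the closed surface braids). -/
local notation "𝕊²" => (Metric.sphere (0 : EuclideanSpace ℝ (Fin 3)) 1)

/-- The braid-FIBRE coordinate `z = x₀ + i x₁` of a point of `S⁴ ⊂ ℝ⁵`. -/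
def zC (x : 𝕊⁴) : ℂ := ⟨x.1 0, x.1 1⟩

/-- The BASE vector `(x₂, x₃, x₄) = (Re w, Im w, t) ∈ ℝ³` of a point of `S⁴`; its direction is the
point of the base `S²` of the braid structure (non-zero on the braid region `|z|² < 1/2`). -/
def baseVec (x : 𝕊⁴) : 𝔼 3 := WithLp.toLp 2 ![x.1 2, x.1 3, x.1 4]

/-- The HEIGHT `t = x₄`; `{t ≥ 0}` and `{t ≤ 0}` are the two hemispherical `4`-balls `B₊`, `B₋` of
`S⁴`, and `{t = 0} = S³ ⊂ ℂ²` is their common boundary (the seam). -/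
def height (x : 𝕊⁴) : ℝ := x.1 4

/-- The northern hemispherical `4`-ball `B₊ = {t ≥ 0}` (a smooth compact `4`-ball). -/
def northBall : Set 𝕊⁴ := {x | 0 ≤ height x}

/-- The southern hemispherical `4`-ball `B₋ = {t ≤ 0}`. -/
def southBall : Set 𝕊⁴ := {x | height x ≤ 0}

/-- The hemisphere bisection covers `S⁴`. -/
theorem northBall_union_southBall : northBall ∪ southBall = (Set.univ : Set 𝕊⁴) := by
  ext x
  simp only [northBall, southBall, mem_union, mem_setOf_eq, mem_univ, iff_true]
  exact (le_total 0 (height x)).imp id id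

/-- The two hemispheres meet exactly in the equatorial `S³ = {t = 0}` (the seam). -/
theorem northBall_inter_southBall : northBall ∩ southBall = {x : 𝕊⁴ | height x = 0} := by
  ext x
  simp only [northBall, southBall, mem_inter_iff, mem_setOf_eq]
  constructor
  · rintro ⟨h₁, h₂⟩
    exact le_antisymm h₂ h₁
  · intro h
    exact ⟨h.ge, h.le⟩

/-- The open BRAID REGION `T° = {|z|² < 1/2} ≅ D̊²_z × S²` (product coordinates
`x ↦ (z, baseVec x / ‖baseVec x‖)`, inverse `(z, u) ↦ (z, √(1-|z|²) u)`); its closure `T` and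
`{|z|² ≥ 1/2} ≅ S¹ × D³` decompose `S⁴ = D² × S² ∪ S¹ × D³`. -/
def braidRegion : Set 𝕊⁴ := {x | (x.1 0) ^ 2 + (x.1 1) ^ 2 < 1 / 2}

/-- Radial retraction `ℝ³ ∖ 0 → S²` (junk value at `0`, never met on the braid region). -/
def toS2 (v : 𝔼 3) : 𝕊² :=
  if h : v = 0 then ⟨EuclideanSpace.single 2 1, by simp⟩
  else ⟨‖v‖⁻¹ • v, by simp [norm_smul, h]⟩

/-- The BRAID PROJECTION `π : S⁴ → S²`, `x ↦ (x₂,x₃,x₄)/‖(x₂,x₃,x₄)‖`; on the braid region its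
fibres are the discs `D²_z × {u}`, and `π⁻¹(hemisphere) ∩ T = B_± ∩ T`. -/
def braidProj (x : 𝕊⁴) : 𝕊² := toS2 (baseVec x)

/-- The VERTICAL PROJECTION `S² → ℂ`, `u ↦ u₀ + i u₁`: a chart on each OPEN hemisphere of `S²`,
orientation-PRESERVING on the north `{u₂ > 0}` and orientation-REVERSING on the south (boundary
orientation of `S² = ∂B³`). Composed with `braidProj` it is the normalised base coordinate
`w' = w/‖(w,t)‖`; `(z, w')` is an orientation-preserving complex chart of `B₊ ∩ T°` carrying the
braid fibration to `{w' = const}`, so Loi–Piergallini's "positive twist point" (fibre-preserving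
orientation-preserving complex coordinates with `S = {w = z²}`) can be written in it verbatim. -/
def wS (u : 𝕊²) : ℂ := ⟨u.1 0, u.1 1⟩

/-- The height `u₂` on the base `S²` (`> 0` north, `< 0` south, `= 0` equator). -/
def heightS (u : 𝕊²) : ℝ := u.1 2

/-! ## §1 The three relational predicates (definition requests D1–D3 of the line card) -/

section Predicates

variable (M : Type) [TopologicalSpace M] [ChartedSpace (𝔼 4) M]
  (S : Type) [TopologicalSpace S] [ChartedSpace (𝔼 2) S]

/-- **D1 `IsSimpleBranchedCover M S f ν σ p d`** — `p : M → S⁴` is a smooth SIMPLE BRANCHED COVERING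
of degree `d` branched along the closed surface `F = f(S) ⊂ S⁴` (`S` an abstract closed surface,
`f` a smooth embedding), presented with PRODUCT TUBES: `ν : S × ℂ ↪ S⁴` is an open tubular
parametrisation of `F` (`ν(s,0) = f s`) and `σ : S × ℂ ↪ M` one of the ramification surface, in which
`p` IS the normal-squaring model `p(σ(s,v)) = ν(s,v²)` (Piergallini–Zuddas arXiv:1602.07459 §1:
Fox completion of an ordinary covering with transposition meridian monodromy; smooth local model
`(u,v) ↦ (u,v²)`); every point of `M` is a local-diffeomorphism point of `p` or lies in the
ramification tube (so over each branch point there is EXACTLY ONE ramification point — simplicity —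
and the other sheets are unbranched); fibres off `F` have exactly `d` points (degree). The product tube
`ν` makes `S × ℂ` an open subset of `S⁴`, hence forces `S` to be ORIENTABLE with trivial normal
bundle — this is how the card's Q_or ("orientable branch surface") is encoded without orientation
vocabulary; conversely, for a simple cover of `S⁴` with orientable embedded branch surface (normal Euler
number `[F]² = 0`, so the normal bundle is trivial) the framing `ν` can always be re-chosen so that the
lift `σ` exists (the obstruction is the class in `H¹(S;ℤ/2)` recording whether `F`-parallel push-offs
exchange the two merging sheets; re-framing by a lift to `H¹(S;ℤ)` kills it), and then `νR` is trivial
too. Manifold axioms, compactness and `2 ≤ d` are not fields (consumers add them). -/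
structure IsSimpleBranchedCover (f : S → 𝕊⁴) (ν : S × ℂ → 𝕊⁴) (σ : S × ℂ → M) (p : M → 𝕊⁴)
    (d : ℕ) : Prop where
  /-- `p` is `C^∞`. -/
  contMDiff : ContMDiff (𝓡 4) (𝓡 4) ∞ p
  /-- the branch surface `F = f(S)` is smoothly embedded (redundant given `ν`, kept for consumers) -/
  isSmoothEmbedding_f : Manifold.IsSmoothEmbedding (𝓡 2) (𝓡 4) ∞ f
  /-- product tube of the branch surface: an open smooth embedding `S × ℂ ↪ S⁴` -/
  isSmoothEmbedding_ν : Manifold.IsSmoothEmbedding ((𝓡 2).prod 𝓘(ℝ, ℂ)) (𝓡 4) ∞ ν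
  /-- product tube of the ramification surface: an open smooth embedding `S × ℂ ↪ M` -/
  isSmoothEmbedding_σ : Manifold.IsSmoothEmbedding ((𝓡 2).prod 𝓘(ℝ, ℂ)) (𝓡 4) ∞ σ
  /-- the core of the tube is the branch surface -/
  ν_zero : ∀ s : S, ν (s, 0) = f s
  /-- in the tubes `p` is the normal squaring `(s, v) ↦ (s, v²)` -/
  model : ∀ (s : S) (v : ℂ), p (σ (s, v)) = ν (s, v ^ 2)
  /-- off the ramification tube `p` is a local diffeomorphism -/
  dichotomy : ∀ y : M, IsLocalDiffeomorphAt (𝓡 4) (𝓡 4) ∞ p y ∨ y ∈ Set.range σ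
  /-- the degree: every fibre off the branch surface has exactly `d` points -/
  card_fibre : ∀ x : 𝕊⁴, x ∉ Set.range f → Nat.card (p ⁻¹' {x}) = d

/-- **D2 `IsSurfaceBraid S f`** — `F = f(S)` is a closed SIMPLE SURFACE BRAID in `S⁴` w.r.t. the fixed
product structure (Kamada arXiv:math/9407217, Definition p.1 and Remark p.2; Loi–Piergallini
arXiv:math/0002042 §1 "braided surface over `Y`"): `F` lies in the open braid region `T°`, and the braid
projection `b = braidProj ∘ f : S → S²` is a local diffeomorphism off a finite set `C` of branch
points with pairwise distinct values, at each of which `b` is the square map in some local coordinates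
(`φ` a local parametrisation of `S` at `c`, `ψ` a local chart of `S²` at `b c`,
`ψ (b (φ ζ)) = ψ (b c) + ζ²` near `0`) — a simple branch point (twist point). The degree `m` of `b` and
the signs of the twist points are not recorded. -/
structure IsSurfaceBraid (f : S → 𝕊⁴) : Prop where
  /-- `F ⊂ T° = {|z|² < 1/2}` -/
  subset_braidRegion : Set.range f ⊆ braidRegion
  /-- `braidProj ∘ f` is a simple branched covering of `S²`: finitely many simple twist points with
  distinct values, a local diffeomorphism elsewhere -/
  exists_branchPoints : ∃ C : Finset S,
    (∀ s : S, s ∉ C → IsLocalDiffeomorphAt (𝓡 2) (𝓡 2) ∞ (fun s => braidProj (f s)) s) ∧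
    Set.InjOn (fun s => braidProj (f s)) C ∧
    ∀ c ∈ C, ∃ (φ : ℂ → S) (ψ : 𝕊² → ℂ), φ 0 = c ∧
      IsLocalDiffeomorphAt 𝓘(ℝ, ℂ) (𝓡 2) ∞ φ 0 ∧
      IsLocalDiffeomorphAt (𝓡 2) 𝓘(ℝ, ℂ) ∞ ψ (braidProj (f c)) ∧
      ∀ᶠ ζ in 𝓝 (0 : ℂ), ψ (braidProj (f (φ ζ))) = ψ (braidProj (f c)) + ζ ^ 2

/-- **D3 `IsSortedSurfaceBraid S f`** — a closed simple surface braid that is SIGN-SORTED BY THE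
EQUATOR: no branch value on the equator of `S²`, and at EVERY twist point `c` the surface is, in the
coordinates `(z, w')` (`w' = wS ∘ braidProj`), EXACTLY the complex curve `z = z_c + ζ`, `w' = w'_c + ζ²`,
i.e. `(z - z_c)² = w' - w'_c` — Loi–Piergallini's positive twist point `{w = z²}` (arXiv:math/0002042
§1) written in a chart which is orientation-preserving over the northern hemisphere and
orientation-REVERSING over the southern one. Hence every twist point over the north is POSITIVE and
every twist point over the south is NEGATIVE for the orientation of `S⁴`: `F ∩ B₊` is a positive
braided surface in the bidisc `B₊ ≅ (D_z ∪ collar) × D₊`, and `F ∩ B₋` is positive for the REVERSED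
orientation of `B₋` (the reflection `t ↦ -t` preserves `z`, `w'` and the formulas). The exact local
model is w.l.o.g.: reachable from any twist point of the right sign by a fibre-preserving isotopy
supported near `c` (radially interpolated linearisation; embeddedness is automatic since the base
coordinate is `ζ²`). -/
structure IsSortedSurfaceBraid (f : S → 𝕊⁴) : Prop where
  /-- `F ⊂ T° = {|z|² < 1/2}` -/
  subset_braidRegion : Set.range f ⊆ braidRegion
  /-- simple twist points off the equator, each in EXACT positive normal form w.r.t. `(z, w')` -/
  exists_branchPoints : ∃ C : Finset S,
    (∀ s : S, s ∉ C → IsLocalDiffeomorphAt (𝓡 2) (𝓡 2) ∞ (fun s => braidProj (f s)) s) ∧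
    Set.InjOn (fun s => braidProj (f s)) C ∧
    ∀ c ∈ C, heightS (braidProj (f c)) ≠ 0 ∧
      ∃ φ : ℂ → S, φ 0 = c ∧ IsLocalDiffeomorphAt 𝓘(ℝ, ℂ) (𝓡 2) ∞ φ 0 ∧
        ∀ᶠ ζ in 𝓝 (0 : ℂ), zC (f (φ ζ)) = zC (f c) + ζ ∧
          wS (braidProj (f (φ ζ))) = wS (braidProj (f c)) + ζ ^ 2

end Predicates

/-! ## §2 The combinatorial core in degree `2` (card's First lemma; SketchIdeator1) -/

/-- One HURWITZ MOVE on a list of signed group elements (signs travel with the letter):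
`(a, b) ↦ (a b a⁻¹, a)` or `(a, b) ↦ (b, b⁻¹ a b)` at two adjacent positions. -/
def HurwitzStep {G : Type*} [Group G] (l l' : List (G × Bool)) : Prop :=
  ∃ (pre suf : List (G × Bool)) (a b : G × Bool),
    l = pre ++ a :: b :: suf ∧
    (l' = pre ++ (a.1 * b.1 * a.1⁻¹, b.2) :: a :: suf ∨
     l' = pre ++ b :: (b.1⁻¹ * a.1 * b.1, a.2) :: suf)

/-- Transitivity (on `Fin m`) of the subgroup generated by a set of permutations. -/
def GenTransitive {m : ℕ} (T : Set (Equiv.Perm (Fin m))) : Prop :=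
  ∀ i j : Fin m, ∃ g ∈ Subgroup.closure T, g i = j

/-- **`HurwitzTransitivity`** (the statement of `stub_hurwitzTransitive`; the card's First lemma
`positive_subsystem_transitive_after_hurwitz`, SketchIdeator1.lean): a list of signed transpositions of
`Fin m` whose letters act jointly transitively and which has at least `m - 1` positive letters is
Hurwitz-equivalent to a list whose POSITIVE letters alone act transitively. Verified by exhaustive
search of full Hurwitz orbits for `m ≤ 4`, length `≤ 6` (kit j005725, ideator: 1 990 398 lists, 0
counterexamples) and independently for `m ≤ 4`, length `≤ 5` (triage r1-2, 108 orbits); `m = 5`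
hand cases (triage r1-1). DICTIONARY (`d = 2`): letters = twist points of the closed surface braid
`F → S²` (a 2-knot of braid index `m`, `2m - 2` letters, `m - 1` of each sign), transposition = the
two merging strands, sign = chirality; a Hurwitz move = an elementary re-choice of the Hurwitz arc
system on `(S², branch values)` (the surface is untouched); positive letters transitive with `m - 1`
of them = `F ∩ B₊` (for `B₊` a regular neighbourhood of the positive sub-star) is `m` discs joined by
a spanning tree of bands = a DISC. -/
def HurwitzTransitivity : Prop :=
  ∀ (m : ℕ) (l : List (Equiv.Perm (Fin m) × Bool)),
    (∀ x ∈ l, ∃ a b : Fin m, a ≠ b ∧ x.1 = Equiv.swap a b) →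
    GenTransitive {g | ∃ x ∈ l, x.1 = g} →
    m ≤ (l.filter (fun x => x.2)).length + 1 →
    ∃ l', Relation.ReflTransGen HurwitzStep l l' ∧
      GenTransitive {g | ∃ x ∈ l', x.2 = true ∧ x.1 = g}

/-! ## §3 The registered stubs -/

/-- **Stub 1 — `Q_or`, the REPRESENTATION step (card K1; OPEN; the line's hardest stub).** Every smooth
homotopy `4`-sphere `M` (Hausdorff, second countable, compact, `C^∞`, `M ≃ₕ S⁴`) is a simple branched
cover `p : M → S⁴` of some degree `d ≥ 2` whose branch locus is a closed ORIENTABLE embedded surface,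
with product tubes (D1). Why plausibly true / what is known: Piergallini 1995 + Iori–Piergallini 2002
(= Piergallini–Zuddas arXiv:1602.07459 Thm 1.1, read p.4) give `d = 4` with a self-transversally
immersed branch surface and `d = 5` with an EMBEDDED locally flat one for EVERY closed connected
oriented PL (= smooth) 4-manifold — but with NO orientability claim; the only known obstruction to an
orientable embedded branch set is Viro's signature formula (`σ(M) = -½ Σ e(νFᵢ)`, and `e = 0` for
orientable surfaces in `S⁴`), i.e. `σ(M) = 0` — satisfied by homotopy spheres and violated by ℂP²
(consistent with Disproof's ℂP² refutation of the simply-connected weakening). First test / attack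
plan: in the Bobtcheva–Piergallini construction (arXiv:1602.07459 §3 p.7, items 1–9) the ribbon branch
surface `S_K ⊂ B⁴` of the 2-handlebody `M₂ ⊂ M` is `A ⊔ B ⊔ B₁ ⊔ … ⊔ B_m`, each piece a disc with closed
bands `A_j` attached along a tree, `A_j` an annulus or a Möbius band according to the PARITY of the
framing of the 2-handle `L_j` ("representing half the framing"); `M` spin ⇒ all framings can be made even
by twists along the dotted circles (the mod-2 obstruction `fr ∈ im V` is exactly `w₂ = 0`), so `S_K` is
ORIENTABLE; what remains is whether the closing cobordism of branch links in `S³ × I` (the covering moves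
normalising `∂M₂ = #ₖS¹×S² → S³` before capping with trivial discs over `♮ₖ S¹×B³ → B⁴`, IP02 §3–4) can
be chosen orientable and compatibly oriented — a concrete, checkable question. `d ≥ 2` is free (add a
trivial sheet along an unknotted sphere). Size: XL / open-problem. Sources: doi:10.1016/0040-9383(94)00034-I,
arXiv:math/0203087, arXiv:1602.07459, Viro 1984 (zbl 0488.57008), Kirby Problem 4.113. -/
theorem stub_orientableBranchedCover :
    ∀ (M : Type) [TopologicalSpace M] [T2Space M] [SecondCountableTopology M] [CompactSpace M]
      [ChartedSpace (𝔼 4) M] [IsManifold (𝓡 4) ∞ M],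
      M ≃ₕ 𝕊⁴ →
      ∃ (d : ℕ) (S : Type) (_ : TopologicalSpace S) (_ : T2Space S) (_ : SecondCountableTopology S)
        (_ : CompactSpace S) (_ : ChartedSpace (𝔼 2) S) (_ : IsManifold (𝓡 2) ∞ S)
        (f : S → 𝕊⁴) (ν : S × ℂ → 𝕊⁴) (σ : S × ℂ → M) (p : M → 𝕊⁴),
        2 ≤ d ∧ IsSimpleBranchedCover M S f ν σ p d := by
  sorry

/-- **Stub 2 — KAMADA BRAIDING (known; Viro–Kamada).** For a compact `M` and a simple branched cover
`p : M → S⁴` with product tubes along `F = f(S)`, there are new data `(f', ν', σ', p')` of the SAME degree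
over the SAME `S` with `F' = f'(S)` a closed simple surface braid w.r.t. the fixed braid structure (D2).
Paper proof: `S × ℂ ↪ S⁴` open ⇒ `S` orientable; Kamada arXiv:math/9407217 Thm 1 (Viro; Kamada, Topology
33 (1994)) and its "advanced version" (Remark p.2: SIMPLE closed 2-dimensional braids): every closed
oriented surface in `ℝ⁴ = S⁴ ∖ pt` is ambient isotopic to the closure in `D² × S²` of a simple surface
braid; carry Kamada's `D² × S²` (a product tubular neighbourhood of an unknotted 2-sphere) onto `T` by an
orientation-preserving diffeomorphism of `S⁴` (unknotted spheres are isotopic; tubular-neighbourhood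
uniqueness matches the disc fibrations); if `Φ` is the end of the ambient isotopy, put `p' = Φ ∘ p`,
`f' = Φ ∘ f`, `ν' = Φ ∘ ν`, `σ' = σ` — still a simple cover with product tubes (`p' ∘ σ = Φ ∘ ν ∘ sq`),
same fibre cardinalities; simple twist points have the local square model by definition (smooth
category: right-left equivalent to `ζ ↦ ζ²`) and distinct values. Size: L (smooth ambient isotopy /
Alexander-type theorem for surfaces; no surface-braid vocabulary in the tree). Sources:
arXiv:math/9407217 Thm 1 + Remark p.2; Kamada, *Braid and Knot Theory in Dimension Four* (AMS 2002). -/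
theorem stub_kamadaBraiding :
    ∀ (M : Type) [TopologicalSpace M] [T2Space M] [SecondCountableTopology M] [CompactSpace M]
      [ChartedSpace (𝔼 4) M] [IsManifold (𝓡 4) ∞ M]
      (S : Type) [TopologicalSpace S] [T2Space S] [SecondCountableTopology S] [CompactSpace S]
      [ChartedSpace (𝔼 2) S] [IsManifold (𝓡 2) ∞ S]
      (f : S → 𝕊⁴) (ν : S × ℂ → 𝕊⁴) (σ : S × ℂ → M) (p : M → 𝕊⁴) (d : ℕ),
      IsSimpleBranchedCover M S f ν σ p d →
      ∃ (f' : S → 𝕊⁴) (ν' : S × ℂ → 𝕊⁴) (σ' : S × ℂ → M) (p' : M → 𝕊⁴),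
        IsSimpleBranchedCover M S f' ν' σ' p' d ∧ IsSurfaceBraid S f' := by
  sorry

/-- **Stub 3 — the DEGREE-2 COMBINATORIAL ENGINE (provable now; pure Mathlib).** `HurwitzTransitivity`
(§2). Why plausibly true: exhaustive for `m ≤ 4`, length `≤ 6`; the only Hurwitz invariants in sight
(ordered product of the letters, generated subgroup, multiset of conjugacy classes) do not obstruct;
candidate proof = induction on the number of positive components, conjugating a cycle edge of a positive
component across a bridging negative letter (triage r1-1's rerouting sketch, hygiene of the travel moves
to be fixed). Size: M. Sources: kit j005725; triage r1-1/r1-2; Kamada–Matsumoto charts for the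
dictionary. -/
theorem stub_hurwitzTransitive : HurwitzTransitivity := by
  sorry

/-- **Stub 4 — SIGN-SORTING IN DEGREE 2 (Kamada's dictionary applied to Stub 3; known modulo Stub 3).**
For `M ≃ₕ S⁴` and a DOUBLE cover `p : M → S⁴` branched along a closed simple surface braid `F = f(S)`
with product tubes, assuming `HurwitzTransitivity`: there are isotopic data `(f', ν', σ', p')` (same `S`,
degree 2) with `F'` SIGN-SORTED (D3) and BOTH hemisphere preimages `p'⁻¹(B₊)`, `p'⁻¹(B₋)` ℚ-acyclic in
positive degrees. Paper proof: (1) the deck involution `σ(s,v) ↦ σ(s,-v)` has fixed set `≅ S`, and `M` is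
a ℤ/2-homology sphere, so Smith theory (Bredon III.7.9/7.11: `Σ bₖ(Fix;ℤ₂) ≤ Σ bₖ(M;ℤ₂) = 2`,
`χ(Fix) ≡ χ(M)`) makes `S ≅ S²`: `F` is a 2-KNOT of some braid index `m ≥ 1` (Riemann–Hurwitz
`χ(F) = 4 - χ(M) = 2` agrees); (2) its braid system over `S²` has `2m - χ(F) = 2m - 2` letters with
trivial product in `B_m` (the loop around all branch values bounds a disc on the far side), so exponent
sum `0`: `m - 1` positive, `m - 1` negative letters; their transpositions act jointly transitively because
`F` is connected; (3) Stub 3 gives a Hurwitz-equivalent SIGNED list with transitive positives, realised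
by a re-choice of the Hurwitz arc system (each Hurwitz move = an elementary arc change; `F` unchanged);
(4) let `D ⊂ S²` be a regular neighbourhood of the sub-star of arcs to the positive values: `F ∩ π⁻¹(D)`
has braid system the positive sub-list, hence is `m` discs + `m - 1` bands forming a tree = a DISC, and
`F ∖ π⁻¹(D̊)` is the complementary disc of the 2-sphere `F`; (5) move `D` onto the northern hemisphere by
an isotopy of `S²`, extended to `S⁴` fibrewise on `T` and by the radially cut-off cone on `S¹ × D³`
(identity near the core), and post-compose `p`, `f`, `ν` with its end `Φ` (`σ' = σ`); (6) the twist points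
over the north are now exactly the positive letters — positive twists for the orientation of `S⁴` — and a
fibre-preserving isotopy supported near each twist point puts it in the exact normal form of D3 (same with
`ζ̄`-free formula over the south, where `w'` reverses orientation); (7) `p'⁻¹(B₊)` is the double cover of
the smooth 4-ball `B₊` branched over the properly embedded disc `F' ∩ B₊` (`0` is a regular value of
`t ∘ p'` since no twist value lies on the equator), a ℚ- (indeed ℤ/2-) homology ball (Casson–Gordon;
transfer/Smith: `H₊(W;ℚ)⁺ = H₊(B⁴;ℚ)`, `χ⁻ = 0`, `∂W = Σ₂(∂-knot)` connected), and likewise `p'⁻¹(B₋)`.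
No Kamada equivalence theorem (braid systems ↔ surface braids) is needed — only arc-system combinatorics.
Size: L. Sources: arXiv:math/9407217; Kamada 2002 (book) Ch. 16–18; Bredon 1972 III §7; Casson–Gordon
1978 Lemma 2 (Σ₂ of a slice disc is a ℚ-homology ball); Loi–Piergallini arXiv:math/0002042 Prop 1.2. -/
theorem stub_signSortingDegreeTwo :
    HurwitzTransitivity →
    ∀ (M : Type) [TopologicalSpace M] [T2Space M] [SecondCountableTopology M] [CompactSpace M]
      [ChartedSpace (𝔼 4) M] [IsManifold (𝓡 4) ∞ M],
      M ≃ₕ 𝕊⁴ →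
      ∀ (S : Type) [TopologicalSpace S] [T2Space S] [SecondCountableTopology S] [CompactSpace S]
        [ChartedSpace (𝔼 2) S] [IsManifold (𝓡 2) ∞ S]
        (f : S → 𝕊⁴) (ν : S × ℂ → 𝕊⁴) (σ : S × ℂ → M) (p : M → 𝕊⁴),
        IsSimpleBranchedCover M S f ν σ p 2 → IsSurfaceBraid S f →
        ∃ (f' : S → 𝕊⁴) (ν' : S × ℂ → 𝕊⁴) (σ' : S × ℂ → M) (p' : M → 𝕊⁴),
          IsSimpleBranchedCover M S f' ν' σ' p' 2 ∧ IsSortedSurfaceBraid S f' ∧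
          ∀ k : ℕ, 0 < k →
            IsZero (singularHomology ℚ ℚ ↥(p' ⁻¹' northBall) k) ∧
            IsZero (singularHomology ℚ ℚ ↥(p' ⁻¹' southBall) k) := by
  sorry

/-- **Stub 5 — SIGN-SORTED SPANNING IN DEGREE `≥ 3` (card K2 for `d ≥ 3`; OPEN combinatorics +
dictionary; second pole of the line).** For `M ≃ₕ S⁴` with a simple cover of degree `d ≥ 3` branched
along a closed simple surface braid with product tubes, there is SOME simple branched cover of `M` over
`S⁴` (any degree `d'`, any closed surface `S'`) which is sign-sorted (D3) with both hemisphere preimages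
ℚ-acyclic in positive degrees. Dictionary (Loi–Piergallini Prop 1.2): `W₊ = p⁻¹(B₊) → D₊` is an
achiral-turned-positive Lefschetz fibration with fibre `P` = the `d`-fold cover of `D²_z` branched at the
`m` braid points (`χ(P) = d - m`, connected, `b₁(P) = m - d + 1`) and one vanishing cycle `c_k` = the
closed lift of the band arc of each twist point over `D₊`; `χ(M) = 2` and the trivial product of the braid
system force `n₊ = n₋ = m - d + 1 = b₁(P)` (Euler balance is an exponent sum), so `W₊` is ℚ-acyclic iff
the positive classes `[c_k]` SPAN `H₁(P;ℚ)`, and then `W₋` is ℚ-acyclic too (Alexander duality in the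
homology sphere — Disproof.lean `acyclicRight_of_acyclicLeft_of_homotopyEquiv'`, or run the engine on
both signs). Engines: (E1) Hurwitz re-choice of the arc system (transvections `T_c(v) = v ± Ω(c,v)c` on
classes) + Kamada STABILISATION of the closed surface braid (arXiv:math/9407217 p.2: one new strand, one
positive and one negative twist point with a common, freely chosen band arc — the exact analogue of the
common ± stabilisation pair of the sibling line `hurwitz-tilt-exchange`, whose exchange protocol lowers
the corank of `span(Pos)` by one per pair; here the initial sign classes need NOT be bases, so the
protocol's bookkeeping must be redone: open) + the local/base isotopies of Stub 4; (E2) Piergallini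
covering moves changing `(d, F)` at fixed `M`. Why it might fail: an invariant of signed `S_d`-coloured
braid systems under Hurwitz moves + stabilisation obstructing positive spanning (none known; for `d = 2`
transitivity suffices, Stub 4). Size: XL. Sources: arXiv:math/0002042 Prop 1.2; arXiv:math/9407217;
arXiv:1104.4536 (APZ); SketchIdeator2 `HurwitzTiltExchange.ExchangeLemma` + triage r1-1/2/3 audits. -/
theorem stub_signSortingHigherDegree :
    ∀ (M : Type) [TopologicalSpace M] [T2Space M] [SecondCountableTopology M] [CompactSpace M]
      [ChartedSpace (𝔼 4) M] [IsManifold (𝓡 4) ∞ M],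
      M ≃ₕ 𝕊⁴ →
      ∀ (S : Type) [TopologicalSpace S] [T2Space S] [SecondCountableTopology S] [CompactSpace S]
        [ChartedSpace (𝔼 2) S] [IsManifold (𝓡 2) ∞ S]
        (f : S → 𝕊⁴) (ν : S × ℂ → 𝕊⁴) (σ : S × ℂ → M) (p : M → 𝕊⁴) (d : ℕ),
        3 ≤ d → IsSimpleBranchedCover M S f ν σ p d → IsSurfaceBraid S f →
        ∃ (d' : ℕ) (S' : Type) (_ : TopologicalSpace S') (_ : T2Space S')
          (_ : SecondCountableTopology S') (_ : CompactSpace S') (_ : ChartedSpace (𝔼 2) S')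
          (_ : IsManifold (𝓡 2) ∞ S')
          (f' : S' → 𝕊⁴) (ν' : S' × ℂ → 𝕊⁴) (σ' : S' × ℂ → M) (p' : M → 𝕊⁴),
          IsSimpleBranchedCover M S' f' ν' σ' p' d' ∧ IsSortedSurfaceBraid S' f' ∧
          ∀ k : ℕ, 0 < k →
            IsZero (singularHomology ℚ ℚ ↥(p' ⁻¹' northBall) k) ∧
            IsZero (singularHomology ℚ ℚ ↥(p' ⁻¹' southBall) k) := by
  sorry

/-- **Stub 6 — PULL-BACK OF THE HEMISPHERE BISECTION (card P1; KNOWN on paper, XL to formalise).** For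
any compact `M` and any simple branched cover `p : M → S⁴` with product tubes whose branch surface is a
SIGN-SORTED closed surface braid (D1 + D3), `M` is a Stein bisection along a common contact seam with
halves EXACTLY the hemisphere preimages: compact `W₁, W₂` with boundary, Stein structures `J₁, J₂`,
smooth embeddings `e₁, e₂` covering `M`, meeting exactly in the images of their boundaries, pushed-forward
complex tangencies equal on the seam, and `range e₁ = p⁻¹(B₊)`, `range e₂ = p⁻¹(B₋)`. Paper proof:
(1) `0` is a regular value of `t ∘ p` (off ramification `dp` is onto and `dt ≠ 0` on `{t = 0}`; at a
ramification point `im dp ⊇ T F` and `F ⋔ {t = 0}` because `braidProj ∘ f` is a local diffeomorphism at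
every point over the equator), so `W₁ := p⁻¹{t ≥ 0}`, `W₂ := p⁻¹{t ≤ 0}` are compact smooth 4-manifolds
with common boundary `Y = p⁻¹(S³)`; (2) `B₊ = (D_z × D₊) ∪ (S¹_z × D³₊) ≅ (D_z ∪ collar) × D₊` is a
bidisc (corners smoothed) whose projection to `D₊` extends the braid projection, `F ∩ B₊` is braided over
`D₊` with only POSITIVE twist points in the orientation-preserving complex chart `(z, w')` (D3 is
Loi–Piergallini's definition verbatim), so `W₁ → B₊` is a cover of `B² × B²` branched over a positive
braided surface and `W₁` is STEIN (arXiv:math/0002042 Thm 2.2, (c) ⇒ (a); Prop 1.2: it is a PALF over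
`D₊` whose boundary open book is the lift of the braid-axis open book `{arg w = θ}` of `S³` along the
transverse closed braid `L = F ∩ S³`); (3) the reflection `t ↦ -t` is orientation-REVERSING on `S⁴`,
fixes the seam pointwise and preserves `z`, `w'`, `T`, so it carries `(B₋, F ∩ B₋)` onto a positive
braided surface in `B₊`: `-W₂` is Stein, with boundary open book the lift of the SAME open book of the
SAME `S³` along the SAME `L` with the same sheet monodromy — literally the same open book of `Y`; (4) a
Stein/PALF structure induces on the boundary the contact structure supported by its boundary open book
(Loi–Piergallini §3 / Akbulut–Ozbagci; = the Harvey–Kawamuro–Plamenevskaya lift `ξ_L` of `ξ_std`,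
arXiv:0712.1557 §2.5, arXiv:math/0412183), and two contact structures supported by one open book are
isotopic (Giroux 2002); (5) Gray's theorem turns the isotopy into a diffeomorphism of `Y` isotopic to the
identity, extended over a collar of `W₂` and absorbed into `e₂` (ranges unchanged), after which the two
plane fields agree POINTWISE on the seam; (6) package as `SteinStructure` (J-convex exhaustion with the
boundary a regular maximal level set: Eliashberg–Gompf / tree `SteinStructure` API) and as
`IsSmoothEmbedding` of the inclusions. Orientation bookkeeping (triage r1-1/r1-2): `J₁` induces
`p^*[S⁴]` on `W₁`, `J₂` the opposite of `p^*[S⁴]` on `W₂`, so both induce the same orientation on `Y` —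
the twisted-double shape the crux forces. Degenerate inputs are harmless (`S = ∅`: `p` is a trivial
covering and the bisection is the hemisphere one on each sheet; `M = ∅`: empty halves). Size: XL (no
Lefschetz-fibration / braided-surface / Giroux vocabulary in the tree; `OpenBook`, `Supports`,
`SteinStructure`, `contactPlane`, `steinStructureClosedBall` exist). Sources: arXiv:math/0002042 Thm 2.2,
Prop 1.2, Thm 1.1 (Rudolph); arXiv:0712.1557 §2.5; arXiv:math/0412183; Giroux ICM 2002; Gompf1998. -/
theorem stub_pullbackSteinBisection :
    ∀ (M : Type) [TopologicalSpace M] [T2Space M] [SecondCountableTopology M] [CompactSpace M]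
      [ChartedSpace (𝔼 4) M] [IsManifold (𝓡 4) ∞ M]
      (S : Type) [TopologicalSpace S] [T2Space S] [SecondCountableTopology S] [CompactSpace S]
      [ChartedSpace (𝔼 2) S] [IsManifold (𝓡 2) ∞ S]
      (f : S → 𝕊⁴) (ν : S × ℂ → 𝕊⁴) (σ : S × ℂ → M) (p : M → 𝕊⁴) (d : ℕ),
      IsSimpleBranchedCover M S f ν σ p d → IsSortedSurfaceBraid S f →
      ∃ (W₁ : Type) (_ : TopologicalSpace W₁) (_ : ChartedSpace (EuclideanHalfSpace 4) W₁)
        (_ : IsManifold (𝓡∂ 4) ∞ W₁) (_ : CompactSpace W₁)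
        (W₂ : Type) (_ : TopologicalSpace W₂) (_ : ChartedSpace (EuclideanHalfSpace 4) W₂)
        (_ : IsManifold (𝓡∂ 4) ∞ W₂) (_ : CompactSpace W₂)
        (J₁ : SteinStructure W₁) (J₂ : SteinStructure W₂) (e₁ : W₁ → M) (e₂ : W₂ → M),
        Manifold.IsSmoothEmbedding (𝓡∂ 4) (𝓡 4) ∞ e₁ ∧
        Manifold.IsSmoothEmbedding (𝓡∂ 4) (𝓡 4) ∞ e₂ ∧
        Set.range e₁ ∪ Set.range e₂ = Set.univ ∧
        Set.range e₁ ∩ Set.range e₂ = e₁ '' (𝓡∂ 4).boundary W₁ ∧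
        Set.range e₁ ∩ Set.range e₂ = e₂ '' (𝓡∂ 4).boundary W₂ ∧
        (∀ w₁ w₂, e₁ w₁ = e₂ w₂ →
          Submodule.map (mfderiv (𝓡∂ 4) (𝓡 4) e₁ w₁).toLinearMap (contactPlane J₁.J w₁) =
            Submodule.map (mfderiv (𝓡∂ 4) (𝓡 4) e₂ w₂).toLinearMap (contactPlane J₂.J w₂)) ∧
        Set.range e₁ = p ⁻¹' northBall ∧ Set.range e₂ = p ⁻¹' southBall := by
  sorry

/-! ## §4 Composition (sorry-free): the crux from the stubs -/

/-- The `∃`-body of the crux for one manifold `M` (verbatim from the route file). -/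
def HasAcyclicSteinBisection (M : Type) [TopologicalSpace M] [ChartedSpace (𝔼 4) M] : Prop :=
  ∃ (W₁ : Type) (_ : TopologicalSpace W₁) (_ : ChartedSpace (EuclideanHalfSpace 4) W₁)
    (_ : IsManifold (𝓡∂ 4) ∞ W₁) (_ : CompactSpace W₁) (W₂ : Type) (_ : TopologicalSpace W₂)
    (_ : ChartedSpace (EuclideanHalfSpace 4) W₂) (_ : IsManifold (𝓡∂ 4) ∞ W₂) (_ : CompactSpace W₂)
    (J₁ : Literature.Geometry.Symplectic.SteinStructure W₁)
    (J₂ : Literature.Geometry.Symplectic.SteinStructure W₂) (e₁ : W₁ → M) (e₂ : W₂ → M),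
    Manifold.IsSmoothEmbedding (𝓡∂ 4) (𝓡 4) ∞ e₁ ∧ Manifold.IsSmoothEmbedding (𝓡∂ 4) (𝓡 4) ∞ e₂ ∧
    Set.range e₁ ∪ Set.range e₂ = Set.univ ∧
    Set.range e₁ ∩ Set.range e₂ = e₁ '' (𝓡∂ 4).boundary W₁ ∧
    Set.range e₁ ∩ Set.range e₂ = e₂ '' (𝓡∂ 4).boundary W₂ ∧
    (∀ w₁ w₂, e₁ w₁ = e₂ w₂ →
      Submodule.map (mfderiv (𝓡∂ 4) (𝓡 4) e₁ w₁).toLinearMap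
          (Literature.Geometry.Symplectic.contactPlane J₁.J w₁) =
        Submodule.map (mfderiv (𝓡∂ 4) (𝓡 4) e₂ w₂).toLinearMap
          (Literature.Geometry.Symplectic.contactPlane J₂.J w₂)) ∧
    (∀ k, 0 < k →
      CategoryTheory.Limits.IsZero
          (Literature.AlgebraicTopology.SingularHomology.singularHomology ℚ ℚ W₁ k) ∧
        CategoryTheory.Limits.IsZero
          (Literature.AlgebraicTopology.SingularHomology.singularHomology ℚ ℚ W₂ k))

/-- The crux is literally `∀ M ≃ₕ S⁴, HasAcyclicSteinBisection M` (definitional). -/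
theorem acyclicBisectionExists_iff :
    _root_.Summit.SmoothPoincare4.SmoothPoincare4.Theses.ConvexBisection.AcyclicBisectionExists ↔
      ∀ (M : Type) [TopologicalSpace M] [T2Space M] [SecondCountableTopology M]
        [ChartedSpace (𝔼 4) M] [IsManifold (𝓡 4) ∞ M],
        M ≃ₕ 𝕊⁴ → HasAcyclicSteinBisection M :=
  Iff.rfl

/-- **Packaging + transport (sorry-free given Stub 6).** A sign-sorted braided simple branched cover of a
compact `M` whose two hemisphere preimages are ℚ-acyclic gives an acyclic Stein bisection of `M`: Stub 6
supplies the Stein bisection with `range eᵢ = p⁻¹(B_±)`, and `IsZero` is transported along the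
homeomorphisms `Wᵢ ≃ₜ range eᵢ` (`IsEmbedding.toHomeomorph`, `Homeomorph.setCongr`,
`singularHomology.mapIso`). This is where the crux's two Stein data and its homological clause meet. -/
theorem hasAcyclicSteinBisection_of_sorted
    (M : Type) [TopologicalSpace M] [T2Space M] [SecondCountableTopology M] [CompactSpace M]
    [ChartedSpace (𝔼 4) M] [IsManifold (𝓡 4) ∞ M]
    (S : Type) [TopologicalSpace S] [T2Space S] [SecondCountableTopology S] [CompactSpace S]
    [ChartedSpace (𝔼 2) S] [IsManifold (𝓡 2) ∞ S]
    (f : S → 𝕊⁴) (ν : S × ℂ → 𝕊⁴) (σ : S × ℂ → M) (p : M → 𝕊⁴) (d : ℕ)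
    (hcov : IsSimpleBranchedCover M S f ν σ p d) (hsort : IsSortedSurfaceBraid S f)
    (hacyc : ∀ k : ℕ, 0 < k →
      IsZero (singularHomology ℚ ℚ ↥(p ⁻¹' northBall) k) ∧
      IsZero (singularHomology ℚ ℚ ↥(p ⁻¹' southBall) k)) :
    HasAcyclicSteinBisection M := by
  obtain ⟨W₁, _, _, _, _, W₂, _, _, _, _, J₁, J₂, e₁, e₂, he₁, he₂, hcover, hseam₁, hseam₂,
      hcontact, hr₁, hr₂⟩ := stub_pullbackSteinBisection M S f ν σ p d hcov hsort
  have E₁ : W₁ ≃ₜ ↥(p ⁻¹' northBall) := he₁.isEmbedding.toHomeomorph.trans (Homeomorph.setCongr hr₁)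
  have E₂ : W₂ ≃ₜ ↥(p ⁻¹' southBall) := he₂.isEmbedding.toHomeomorph.trans (Homeomorph.setCongr hr₂)
  refine ⟨W₁, inferInstance, inferInstance, inferInstance, inferInstance, W₂, inferInstance,
    inferInstance, inferInstance, inferInstance, J₁, J₂, e₁, e₂, he₁, he₂, hcover, hseam₁, hseam₂,
    hcontact, fun k hk => ⟨?_, ?_⟩⟩
  · exact (hacyc k hk).1.of_iso (singularHomology.mapIso ℚ ℚ E₁ k)
  · exact (hacyc k hk).2.of_iso (singularHomology.mapIso ℚ ℚ E₂ k)

/-- **The d = 2 STRATUM THEOREM (card P2; triage r1-3's recommended deliverable), modulo Stubs 2, 3, 4, 6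
— no `Q_or`.** A homotopy `4`-sphere which IS a double cover of `S⁴` branched along a closed orientable
surface (product tubes; by Smith theory the surface is then a 2-knot) has an acyclic Stein bisection along a
common contact seam. -/
theorem hasAcyclicSteinBisection_of_doubleBranchedCover
    (M : Type) [TopologicalSpace M] [T2Space M] [SecondCountableTopology M]
    [ChartedSpace (𝔼 4) M] [IsManifold (𝓡 4) ∞ M] (e : M ≃ₕ 𝕊⁴)
    (S : Type) [TopologicalSpace S] [T2Space S] [SecondCountableTopology S] [CompactSpace S]
    [ChartedSpace (𝔼 2) S] [IsManifold (𝓡 2) ∞ S]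
    (f : S → 𝕊⁴) (ν : S × ℂ → 𝕊⁴) (σ : S × ℂ → M) (p : M → 𝕊⁴)
    (hcov : IsSimpleBranchedCover M S f ν σ p 2) :
    HasAcyclicSteinBisection M := by
  haveI : CompactSpace M :=
    Literature.Topology.FourManifolds.compactSpace_of_homotopyEquiv_sphere_four_holds M e
  obtain ⟨f₁, ν₁, σ₁, p₁, hcov₁, hbraid₁⟩ := stub_kamadaBraiding M S f ν σ p 2 hcov
  obtain ⟨f₂, ν₂, σ₂, p₂, hcov₂, hsort₂, hacyc₂⟩ :=
    stub_signSortingDegreeTwo stub_hurwitzTransitive M e S f₁ ν₁ σ₁ p₁ hcov₁ hbraid₁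
  exact hasAcyclicSteinBisection_of_sorted M S f₂ ν₂ σ₂ p₂ 2 hcov₂ hsort₂ hacyc₂

/-- **CRUX FROM THE LINE.** `ConvexBisection.AcyclicBisectionExists` (stmt-SmoothPoincare4-10508) follows
from the six stubs: represent (Stub 1), braid (Stub 2), sort by degree (Stubs 3 + 4 for `d = 2`, Stub 5
for `d ≥ 3`), pull back the hemisphere bisection and transport acyclicity (Stub 6, through
`hasAcyclicSteinBisection_of_sorted`). The homotopy equivalence `M ≃ₕ S⁴` is consumed three times
(compactness of `M`; Stub 1; Stubs 4/5), honouring `acyclicBisectionExists_false_without_homotopyEquiv`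
of Disproof.lean. -/
theorem AcyclicBisectionExists_of :
    _root_.Summit.SmoothPoincare4.SmoothPoincare4.Theses.ConvexBisection.AcyclicBisectionExists := by
  intro M _ _ _ _ _ e
  haveI : CompactSpace M :=
    Literature.Topology.FourManifolds.compactSpace_of_homotopyEquiv_sphere_four_holds M e
  obtain ⟨d, S, _, _, _, _, _, _, f, ν, σ, p, hd, hcov⟩ := stub_orientableBranchedCover M e
  obtain ⟨f₁, ν₁, σ₁, p₁, hcov₁, hbraid₁⟩ := stub_kamadaBraiding M S f ν σ p d hcov
  rcases Nat.lt_or_ge d 3 with hlt | hge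
  · -- degree 2: Stubs 3 + 4
    obtain rfl : d = 2 := by omega
    obtain ⟨f₂, ν₂, σ₂, p₂, hcov₂, hsort₂, hacyc₂⟩ :=
      stub_signSortingDegreeTwo stub_hurwitzTransitive M e S f₁ ν₁ σ₁ p₁ hcov₁ hbraid₁
    exact hasAcyclicSteinBisection_of_sorted M S f₂ ν₂ σ₂ p₂ 2 hcov₂ hsort₂ hacyc₂
  · -- degree ≥ 3: Stub 5
    obtain ⟨d', S', _, _, _, _, _, _, f', ν', σ', p', hcov', hsort', hacyc'⟩ :=
      stub_signSortingHigherDegree M e S f₁ ν₁ σ₁ p₁ d hge hcov₁ hbraid₁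
    exact hasAcyclicSteinBisection_of_sorted M S' f' ν' σ' p' d' hcov' hsort' hacyc'

end Summit.SmoothPoincare4.SmoothPoincare4.Cruxes.AcyclicBisectionExists.BraidedBranchLocus

end
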